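import Summits.CriticalPhenomena.PercolationContinuityZ3.Theorems.PercNearOneGluingNoHeavyLowerTailGiantKnKFold
import Summits.CriticalPhenomena.PercolationContinuityZ3.Theorems.PercNearOneGluingNoHeavyLowerTailGiantKnPhiMono
import Summits.CriticalPhenomena.PercolationContinuityZ3.Theorems.PercNearOneGluingNoHeavyLowerTailGiantKnCore
import HarnessLib

/-!
# `NoHeavyLowerTail` (stmt-CriticalPhenomena-4575) — `XZ_T` from Kozma–Nitzan certificates: numeric, top-absorbing, flow

Support file (prover `prim-lf-7`, lemma factory "k-cluster conditional association"; `--supports stmt-CriticalPhenomena-4575`).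
No definitions, no named facts, no sorries.

Setting as in `…GiantKnKFold.lean`: ladder `|A| ≤ 2j+1`, `S = insert c T` (`c ∉ T`), trace patterns `m_B = μ(Γ∩S = B)`,
`m̄_B = μ(Γ∩S = S∖B)`, `Δ_B = m_B − m̄_B`, KN weights `φ_B = μ(o↔B | B ↮ S∖B)`; `slack(XZ_T) ≥ Σ_{∅≠B⊆T} φ_B Δ_B` (`patternStep`).
Pushing rules (all BHK, landed): `φ_B ≥ Σ_{x∈B} φ_x` (`knK_lemma2`), `φ_{B₁}+φ_{B₂} ≤ φ_{B₁∪B₂}` (`phi_superadd`), `φ_B ≤ φ_{B'}` (`phi_mono`).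

* `GiantKn.xzT_of_certificate` — `XZ_T` from the numeric certificate `0 ≤ Σ_B φ_B Δ_B` (isolates the BHK part).
* `GiantKn.xzT_of_topAbsorbing` — with `𝓑 = {B ⊆ T : 2 ≤ |B|, B ≠ T}`: if (H1) `Σ_{B∈𝓑} (m̄_B − m_B)⁺ ≤ m_T − m̄_T` and
  (H2) `Σ_{B∈𝓑, x∉B} (m̄_B − m_B)⁺ ≤ μ(c light) − μ(x light)` for every `x ∈ T`, then `XZ_T`.  `|T| = 2`: KN Theorem 2 verbatim;
  contains the fully-clustered regime of `xzT_of_clustered`.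
* `GiantKn.xzT_of_knFlow` — `XZ_T` from any nonnegative flow along strict inclusions moving positive increments to sub-blocks /
  negative increments to super-blocks (`core_flow` + `phi_mono`).
Reach on the TOP rung `T = A∖c` (i.e. `XZ = CST`) over random structured laws (prim-lf-7 CANDIDATES batch 8): top-absorbing
84 / 82 / 79 %, flow 88 / 87 / 93 %, union 96 / 92 / 93 % at `(k,j) = (5,2) / (6,3) / (7,3)`, versus 10 / 18 / 0 % for the
fully-clustered regime; the numeric certificate holds on 100 % of them and fails only on anti-clustered hub / cut-vertex families,
where `XZ_T` still holds (regime-free conjecture `KNB_T`, 0 violations / 50 k instances).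
[cite: KozmaNitzan2024, Thm. 2 (pp. 8–9), Lemmas 1–2 (pp. 5–6); VandenbergHaggstromKahn2005, Thms. 1.3, 1.4, 2.1]
-/

noncomputable section

namespace Summit.CriticalPhenomena.PercolationContinuityZ3.Theorems

open MeasureTheory Set Literature.Probability.LatticeModels Literature.Probability.Percolation
open scoped Classical BigOperators

variable {n : ℕ}

namespace GiantKn

/-- **`XZ_T` from the numeric Kozma–Nitzan certificate (PROVED).**  Ladder, `S = insert c T`, `c ∉ T`, points of `S` simultaneously
separable with positive probability.  If `0 ≤ Σ_{∅≠B⊆T} φ_B (m_B − m̄_B)` with `φ_B = μ(B ↮ S∖B, o↔B)/μ(B ↮ S∖B)` (KN's conditional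
attachment probability), then `μ(o↔T, o light, c heavy) ≤ μ(o↔T, o heavy, c light)`.  This isolates the BHK part (`patternStep`) of every
KN-type argument: any pushing scheme (`knK_lemma2`, `phi_superadd`, `phi_mono`) that proves the certificate nonnegative proves `XZ_T`.
Numerically the certificate is nonnegative on all random structured laws tested and fails only on anti-clustered hub / cut-vertex
families (prim-lf-7 CANDIDATES batches 6–8). [cite: KozmaNitzan2024, proof of Thm. 2 (pp. 8–9); VandenbergHaggstromKahn2005, Thm. 2.1] -/
theorem xzT_of_certificate (w : Sym2 (Fin n) → unitInterval) (A S T : Finset (Fin n)) (o c : Fin n) (j : ℕ)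
    (hA : A.card ≤ 2 * j + 1) (hS : S = insert c T) (hc : c ∉ T)
    (hM : 0 < (prodBernoulli w).real {ω : BondConfig (Fin n) | ∀ k ∈ S, ∀ l ∈ S, k ≠ l → ¬ (openGraph ω).Reachable k l})
    (hcert : 0 ≤ ∑ B ∈ T.powerset.filter (fun B => B.Nonempty),
      (prodBernoulli w).real ({ω : BondConfig (Fin n) | ∀ s ∈ B, ∀ t ∈ S \ B, ¬ (openGraph ω).Reachable s t} ∩
            ⋃ s ∈ B, (openConn s o : Set (BondConfig (Fin n)))) /
          (prodBernoulli w).real {ω : BondConfig (Fin n) | ∀ s ∈ B, ∀ t ∈ S \ B, ¬ (openGraph ω).Reachable s t} *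
        ((prodBernoulli w).real {ω : BondConfig (Fin n) | ∀ s ∈ S, (j + 1 ≤ (A.filter fun a => ω ∈ openConn s a).card ↔ s ∈ B)} -
          (prodBernoulli w).real {ω : BondConfig (Fin n) | ∀ s ∈ S, (j + 1 ≤ (A.filter fun a => ω ∈ openConn s a).card ↔ s ∈ S \ B)})) :
    (prodBernoulli w).real ((⋃ t ∈ T, (openConn o t : Set (BondConfig (Fin n)))) ∩
        {ω | (A.filter fun a => ω ∈ openConn o a).card ≤ j} ∩ {ω | j + 1 ≤ (A.filter fun a => ω ∈ openConn c a).card}) ≤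
      (prodBernoulli w).real ((⋃ t ∈ T, (openConn o t : Set (BondConfig (Fin n)))) ∩
        {ω | j + 1 ≤ (A.filter fun a => ω ∈ openConn o a).card} ∩ {ω | (A.filter fun a => ω ∈ openConn c a).card ≤ j}) := by
  rw [attachedLight_eq_sum w A S T o c j hS hc, attachedHeavy_eq_sum w A S T o c j hS hc]
  set μ := prodBernoulli w with hμ
  have hTS : T ⊆ S := by rw [hS]; exact Finset.subset_insert c T
  set I := T.powerset.filter (fun B => B.Nonempty) with hI
  set P : Finset (Fin n) → ℝ := fun B => μ.real ({ω : BondConfig (Fin n) | ∀ s ∈ S, (j + 1 ≤ (A.filter fun a => ω ∈ openConn s a).card ↔ s ∈ B)} ∩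
      ⋃ s ∈ B, (openConn s o : Set (BondConfig (Fin n)))) with hP
  set N : Finset (Fin n) → ℝ := fun B => μ.real ({ω : BondConfig (Fin n) | ∀ s ∈ S, (j + 1 ≤ (A.filter fun a => ω ∈ openConn s a).card ↔ s ∈ S \ B)} ∩
      ⋃ s ∈ B, (openConn s o : Set (BondConfig (Fin n)))) with hN
  set m : Finset (Fin n) → ℝ := fun B => μ.real {ω : BondConfig (Fin n) | ∀ s ∈ S, (j + 1 ≤ (A.filter fun a => ω ∈ openConn s a).card ↔ s ∈ B)} with hm
  set mb : Finset (Fin n) → ℝ := fun B => μ.real {ω : BondConfig (Fin n) | ∀ s ∈ S, (j + 1 ≤ (A.filter fun a => ω ∈ openConn s a).card ↔ s ∈ S \ B)} with hmb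
  set d : Finset (Fin n) → ℝ := fun B => μ.real {ω : BondConfig (Fin n) | ∀ s ∈ B, ∀ t ∈ S \ B, ¬ (openGraph ω).Reachable s t} with hd
  set av : Finset (Fin n) → ℝ := fun B => μ.real ({ω : BondConfig (Fin n) | ∀ s ∈ B, ∀ t ∈ S \ B, ¬ (openGraph ω).Reachable s t} ∩
      ⋃ s ∈ B, (openConn s o : Set (BondConfig (Fin n)))) with hav
  change 0 ≤ ∑ B ∈ I, av B / d B * (m B - mb B) at hcert
  change ∑ B ∈ I, N B ≤ ∑ B ∈ I, P B
  have hdpos : ∀ B, B ⊆ S → 0 < d B := by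
    intro B hBS
    refine lt_of_lt_of_le hM (measureReal_mono ?_ (measure_ne_top _ _))
    intro ω hω s hs t ht
    exact hω s (hBS hs) t (Finset.mem_sdiff.1 ht).1 (fun h => (Finset.mem_sdiff.1 ht).2 (h ▸ hs))
  have step1 : ∀ B ∈ I, av B / d B * (m B - mb B) ≤ P B - N B := by
    intro B hB
    rw [hI, Finset.mem_filter, Finset.mem_powerset] at hB
    have k := patternStep w A S T B o c j hA hS hc hB.1 hB.2
    change (P B - N B) * d B ≥ av B * (m B - mb B) at k
    rw [div_mul_eq_mul_div, div_le_iff₀ (hdpos B (hB.1.trans hTS))]; linarith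
  have key : ∑ B ∈ I, av B / d B * (m B - mb B) ≤ ∑ B ∈ I, (P B - N B) := Finset.sum_le_sum step1
  rw [Finset.sum_sub_distrib] at key
  linarith

end GiantKn

namespace GiantKn

/-- **`XZ_T` in the TOP-ABSORBING regime (PROVED) — the k-fold Kozma–Nitzan argument with the negative blocks absorbed at the top.**
Ladder `|A| ≤ 2j+1`, `S = insert c T` (`c ∉ T`, `|T| ≥ 2`), the points of `S` simultaneously separable with positive probability.
With `m_B = μ(pattern B)`, `m̄_B = μ(pattern S∖B)` and the proper blocks `𝓑 = {B ⊆ T : 2 ≤ |B|, B ≠ T}`: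
if  (H1) `Σ_{B∈𝓑} (m̄_B − m_B)⁺ ≤ m_T − m̄_T`  and  (H2) for every `x ∈ T`, `Σ_{B∈𝓑, x∉B} (m̄_B − m_B)⁺ ≤ μ(c light) − μ(x light)`,
then `μ(o↔T, o light, c heavy) ≤ μ(o↔T, o heavy, c light)`.
For `|T| = 2` (`𝓑 = ∅`) this is exactly Kozma–Nitzan's Theorem 2 (`m₃ ≤ m₁₂`, `a₃` the minimiser); the fully-clustered regime of
`xzT_of_clustered` is the case where every `(m̄_B − m_B)⁺` vanishes.  Proof: `patternStep` per block; negative proper blocks are moved to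
the top with `phi_mono` (`φ_B ≤ φ_T`), positive blocks and the top surplus are pushed to singletons with `knK_lemma2`, and the singleton
coefficients telescope to `μ(L_c) − μ(L_x) − Σ_{B∌x}(m̄_B − m_B)⁺ ≥ 0` (`core_topAbsorbing`).
[cite: KozmaNitzan2024, Thm. 2 (pp. 8–9), Lemmas 1–2 (pp. 5–6); VandenbergHaggstromKahn2005, Thms. 1.3, 1.4, 2.1] -/
theorem xzT_of_topAbsorbing (w : Sym2 (Fin n) → unitInterval) (A S T : Finset (Fin n)) (o c : Fin n) (j : ℕ)
    (hA : A.card ≤ 2 * j + 1) (hS : S = insert c T) (hc : c ∉ T) (hT2 : 2 ≤ T.card)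
    (hM : 0 < (prodBernoulli w).real {ω : BondConfig (Fin n) | ∀ k ∈ S, ∀ l ∈ S, k ≠ l → ¬ (openGraph ω).Reachable k l})
    (H1 : ∑ B ∈ T.powerset.filter (fun B => 2 ≤ B.card ∧ B ≠ T),
        max ((prodBernoulli w).real {ω : BondConfig (Fin n) | ∀ s ∈ S, (j + 1 ≤ (A.filter fun a => ω ∈ openConn s a).card ↔ s ∈ S \ B)} -
          (prodBernoulli w).real {ω : BondConfig (Fin n) | ∀ s ∈ S, (j + 1 ≤ (A.filter fun a => ω ∈ openConn s a).card ↔ s ∈ B)}) 0 ≤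
      (prodBernoulli w).real {ω : BondConfig (Fin n) | ∀ s ∈ S, (j + 1 ≤ (A.filter fun a => ω ∈ openConn s a).card ↔ s ∈ T)} -
        (prodBernoulli w).real {ω : BondConfig (Fin n) | ∀ s ∈ S, (j + 1 ≤ (A.filter fun a => ω ∈ openConn s a).card ↔ s ∈ S \ T)})
    (H2 : ∀ x ∈ T, ∑ B ∈ (T.powerset.filter (fun B => 2 ≤ B.card ∧ B ≠ T)).filter (fun B => x ∉ B),
        max ((prodBernoulli w).real {ω : BondConfig (Fin n) | ∀ s ∈ S, (j + 1 ≤ (A.filter fun a => ω ∈ openConn s a).card ↔ s ∈ S \ B)} -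
          (prodBernoulli w).real {ω : BondConfig (Fin n) | ∀ s ∈ S, (j + 1 ≤ (A.filter fun a => ω ∈ openConn s a).card ↔ s ∈ B)}) 0 ≤
      (prodBernoulli w).real {ω : BondConfig (Fin n) | (A.filter fun a => ω ∈ openConn c a).card ≤ j} -
        (prodBernoulli w).real {ω : BondConfig (Fin n) | (A.filter fun a => ω ∈ openConn x a).card ≤ j}) :
    (prodBernoulli w).real ((⋃ t ∈ T, (openConn o t : Set (BondConfig (Fin n)))) ∩
        {ω | (A.filter fun a => ω ∈ openConn o a).card ≤ j} ∩ {ω | j + 1 ≤ (A.filter fun a => ω ∈ openConn c a).card}) ≤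
      (prodBernoulli w).real ((⋃ t ∈ T, (openConn o t : Set (BondConfig (Fin n)))) ∩
        {ω | j + 1 ≤ (A.filter fun a => ω ∈ openConn o a).card} ∩ {ω | (A.filter fun a => ω ∈ openConn c a).card ≤ j}) := by
  rw [attachedLight_eq_sum w A S T o c j hS hc, attachedHeavy_eq_sum w A S T o c j hS hc]
  set μ := prodBernoulli w with hμ
  have hTS : T ⊆ S := by rw [hS]; exact Finset.subset_insert c T
  have hcS : c ∈ S := by rw [hS]; exact Finset.mem_insert_self c T
  set I := T.powerset.filter (fun B => B.Nonempty) with hI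
  set P : Finset (Fin n) → ℝ := fun B => μ.real ({ω : BondConfig (Fin n) | ∀ s ∈ S, (j + 1 ≤ (A.filter fun a => ω ∈ openConn s a).card ↔ s ∈ B)} ∩
      ⋃ s ∈ B, (openConn s o : Set (BondConfig (Fin n)))) with hP
  set N : Finset (Fin n) → ℝ := fun B => μ.real ({ω : BondConfig (Fin n) | ∀ s ∈ S, (j + 1 ≤ (A.filter fun a => ω ∈ openConn s a).card ↔ s ∈ S \ B)} ∩
      ⋃ s ∈ B, (openConn s o : Set (BondConfig (Fin n)))) with hN
  set m : Finset (Fin n) → ℝ := fun B => μ.real {ω : BondConfig (Fin n) | ∀ s ∈ S, (j + 1 ≤ (A.filter fun a => ω ∈ openConn s a).card ↔ s ∈ B)} with hm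
  set mb : Finset (Fin n) → ℝ := fun B => μ.real {ω : BondConfig (Fin n) | ∀ s ∈ S, (j + 1 ≤ (A.filter fun a => ω ∈ openConn s a).card ↔ s ∈ S \ B)} with hmb
  set d : Finset (Fin n) → ℝ := fun B => μ.real {ω : BondConfig (Fin n) | ∀ s ∈ B, ∀ t ∈ S \ B, ¬ (openGraph ω).Reachable s t} with hd
  set av : Finset (Fin n) → ℝ := fun B => μ.real ({ω : BondConfig (Fin n) | ∀ s ∈ B, ∀ t ∈ S \ B, ¬ (openGraph ω).Reachable s t} ∩
      ⋃ s ∈ B, (openConn s o : Set (BondConfig (Fin n)))) with hav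
  set φ : Finset (Fin n) → ℝ := fun B => av B / d B with hφ
  set Δ : Finset (Fin n) → ℝ := fun B => m B - mb B with hΔ
  set ℓ : Fin n → ℝ := fun x => μ.real {ω : BondConfig (Fin n) | (A.filter fun a => ω ∈ openConn c a).card ≤ j} -
      μ.real {ω : BondConfig (Fin n) | (A.filter fun a => ω ∈ openConn x a).card ≤ j} with hℓ
  change ∑ B ∈ I, N B ≤ ∑ B ∈ I, P B
  have hdpos : ∀ B, B ⊆ S → 0 < d B := by
    intro B hBS
    refine lt_of_lt_of_le hM (measureReal_mono ?_ (measure_ne_top _ _))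
    intro ω hω s hs t ht
    exact hω s (hBS hs) t (Finset.mem_sdiff.1 ht).1 (fun h => (Finset.mem_sdiff.1 ht).2 (h ▸ hs))
  -- step 1: per-pattern KN step
  have step1 : ∀ B ∈ I, φ B * Δ B ≤ P B - N B := by
    intro B hB
    rw [hI, Finset.mem_filter, Finset.mem_powerset] at hB
    have k := patternStep w A S T B o c j hA hS hc hB.1 hB.2
    change (P B - N B) * d B ≥ av B * (m B - mb B) at k
    have hdB := hdpos B (hB.1.trans hTS)
    show av B / d B * (m B - mb B) ≤ P B - N B
    rw [div_mul_eq_mul_div, div_le_iff₀ hdB]; linarith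
  -- Lemma 2 on singletons
  have eDsingle : ∀ x ∈ S, {ω : BondConfig (Fin n) | ∀ s ∈ ({x} : Finset (Fin n)), ∀ t ∈ S \ {x}, ¬ (openGraph ω).Reachable s t} =
      {ω : BondConfig (Fin n) | ∀ x' ∈ S.erase x, ¬ (openGraph ω).Reachable x x'} := by
    intro x _; ext ω; simp only [mem_setOf_eq, Finset.mem_singleton, forall_eq, Finset.sdiff_singleton_eq_erase]
  have eAsingle : ∀ x : Fin n, (⋃ s ∈ ({x} : Finset (Fin n)), (openConn s o : Set (BondConfig (Fin n)))) = openConn x o := by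
    intro x; ext ω; simp only [mem_iUnion, Finset.mem_singleton, exists_prop, exists_eq_left]
  have eDcoe : ∀ B : Finset (Fin n), {ω : BondConfig (Fin n) | ∀ s ∈ B, ∀ x' ∈ (↑(S \ B) : Set (Fin n)), ¬ (openGraph ω).Reachable s x'} =
      {ω : BondConfig (Fin n) | ∀ s ∈ B, ∀ t ∈ S \ B, ¬ (openGraph ω).Reachable s t} := by
    intro B; ext ω; simp only [mem_setOf_eq, Finset.mem_coe]
  have hφsingle : ∀ x ∈ S, φ {x} = μ.real ({ω : BondConfig (Fin n) | ∀ x' ∈ S.erase x, ¬ (openGraph ω).Reachable x x'} ∩ openConn x o) /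
      μ.real {ω : BondConfig (Fin n) | ∀ x' ∈ S.erase x, ¬ (openGraph ω).Reachable x x'} := by
    intro x hx
    show μ.real ({ω : BondConfig (Fin n) | ∀ s ∈ ({x} : Finset (Fin n)), ∀ t ∈ S \ {x}, ¬ (openGraph ω).Reachable s t} ∩
        ⋃ s ∈ ({x} : Finset (Fin n)), (openConn s o : Set (BondConfig (Fin n)))) /
      μ.real {ω : BondConfig (Fin n) | ∀ s ∈ ({x} : Finset (Fin n)), ∀ t ∈ S \ {x}, ¬ (openGraph ω).Reachable s t} = _
    rw [eDsingle x hx, eAsingle x]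
  have hL2 : ∀ B, B ⊆ T → ∑ x ∈ B, φ {x} ≤ φ B := by
    intro B hBT
    have hBS : B ⊆ S := hBT.trans hTS
    have hMB : 0 < μ.real {ω : BondConfig (Fin n) | ∀ k ∈ B, ∀ l ∈ S, k ≠ l → ¬ (openGraph ω).Reachable k l} :=
      lt_of_lt_of_le hM (measureReal_mono (fun ω hω k hk l hl hkl => hω k (hBS hk) l hl hkl) (measure_ne_top _ _))
    have h := knK_lemma2 w o S B hBS hMB
    rw [eDcoe B] at h
    rw [Finset.sum_congr rfl (fun x hx => hφsingle x (hBS hx))]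
    exact h
  -- monotonicity towards the top
  have hmono : ∀ B, B ⊆ T → B.Nonempty → φ B ≤ φ T := by
    intro B hBT _
    have h := phi_mono w o S B T hBT hTS hM
    change av B * d T ≤ d B * av T at h
    show av B / d B ≤ av T / d T
    rw [div_le_div_iff₀ (hdpos B (hBT.trans hTS)) (hdpos T hTS)]
    linarith
  -- telescoping
  have htel : ∀ x ∈ T, ∑ B ∈ T.powerset.filter (fun B => x ∈ B), Δ B = ℓ x := by
    intro x hx
    show ∑ B ∈ T.powerset.filter (fun B => x ∈ B), (m B - mb B) = _
    rw [Finset.sum_sub_distrib]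
    change ∑ B ∈ T.powerset.filter (fun B => x ∈ B), μ.real {ω : BondConfig (Fin n) | ∀ s ∈ S, (j + 1 ≤ (A.filter fun a => ω ∈ openConn s a).card ↔ s ∈ B)} -
        ∑ B ∈ T.powerset.filter (fun B => x ∈ B), μ.real {ω : BondConfig (Fin n) | ∀ s ∈ S, (j + 1 ≤ (A.filter fun a => ω ∈ openConn s a).card ↔ s ∈ S \ B)} = _
    rw [sum_pattern_eq w A S T c x j hS hc hx, sum_copattern_eq w A S T c x j hS hc hx]
    have s1 := OwnDisconnection.split w {ω : BondConfig (Fin n) | (A.filter fun a => ω ∈ openConn c a).card ≤ j}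
      {ω : BondConfig (Fin n) | j + 1 ≤ (A.filter fun a => ω ∈ openConn x a).card}
    have s2 := OwnDisconnection.split w {ω : BondConfig (Fin n) | (A.filter fun a => ω ∈ openConn x a).card ≤ j}
      {ω : BondConfig (Fin n) | j + 1 ≤ (A.filter fun a => ω ∈ openConn c a).card}
    have c1 : ({ω : BondConfig (Fin n) | j + 1 ≤ (A.filter fun a => ω ∈ openConn x a).card}ᶜ : Set (BondConfig (Fin n))) =
        {ω | (A.filter fun a => ω ∈ openConn x a).card ≤ j} := by ext ω; simp only [mem_compl_iff, mem_setOf_eq, not_le]; omega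
    have c2 : ({ω : BondConfig (Fin n) | j + 1 ≤ (A.filter fun a => ω ∈ openConn c a).card}ᶜ : Set (BondConfig (Fin n))) =
        {ω | (A.filter fun a => ω ∈ openConn c a).card ≤ j} := by ext ω; simp only [mem_compl_iff, mem_setOf_eq, not_le]; omega
    rw [c1] at s1; rw [c2] at s2
    have i1 : ({ω : BondConfig (Fin n) | (A.filter fun a => ω ∈ openConn c a).card ≤ j} ∩ {ω | j + 1 ≤ (A.filter fun a => ω ∈ openConn x a).card} :
        Set (BondConfig (Fin n))) = {ω | j + 1 ≤ (A.filter fun a => ω ∈ openConn x a).card} ∩ {ω | (A.filter fun a => ω ∈ openConn c a).card ≤ j} :=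
      inter_comm _ _
    have i2 : ({ω : BondConfig (Fin n) | (A.filter fun a => ω ∈ openConn x a).card ≤ j} ∩ {ω | j + 1 ≤ (A.filter fun a => ω ∈ openConn c a).card} :
        Set (BondConfig (Fin n))) = {ω | j + 1 ≤ (A.filter fun a => ω ∈ openConn c a).card} ∩ {ω | (A.filter fun a => ω ∈ openConn x a).card ≤ j} :=
      inter_comm _ _
    have i3 : ({ω : BondConfig (Fin n) | (A.filter fun a => ω ∈ openConn c a).card ≤ j} ∩ {ω | (A.filter fun a => ω ∈ openConn x a).card ≤ j} :
        Set (BondConfig (Fin n))) = {ω | (A.filter fun a => ω ∈ openConn x a).card ≤ j} ∩ {ω | (A.filter fun a => ω ∈ openConn c a).card ≤ j} :=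
      inter_comm _ _
    rw [i1] at s1; rw [i2, ← i3] at s2
    show _ = μ.real {ω : BondConfig (Fin n) | (A.filter fun a => ω ∈ openConn c a).card ≤ j} -
      μ.real {ω : BondConfig (Fin n) | (A.filter fun a => ω ∈ openConn x a).card ≤ j}
    linarith
  -- hypotheses in Δ-form
  have H1' : ∑ B ∈ T.powerset.filter (fun B => 2 ≤ B.card ∧ B ≠ T), max (-Δ B) 0 ≤ Δ T := by
    have e : ∀ B, max (-Δ B) 0 = max (mb B - m B) 0 := fun B => by show max (-(m B - mb B)) 0 = _; rw [neg_sub]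
    simp only [e]; exact H1
  have H2' : ∀ x ∈ T, ∑ B ∈ (T.powerset.filter (fun B => 2 ≤ B.card ∧ B ≠ T)).filter (fun B => x ∉ B), max (-Δ B) 0 ≤ ℓ x := by
    intro x hx
    have e : ∀ B, max (-Δ B) 0 = max (mb B - m B) 0 := fun B => by show max (-(m B - mb B)) 0 = _; rw [neg_sub]
    simp only [e]; exact H2 x hx
  have hφ0 : ∀ x ∈ T, 0 ≤ φ {x} := fun x _ => div_nonneg measureReal_nonneg measureReal_nonneg
  have core := core_topAbsorbing T hT2 φ Δ ℓ hφ0 hL2 hmono htel H1' H2'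
  have key : ∑ B ∈ I, φ B * Δ B ≤ ∑ B ∈ I, (P B - N B) := Finset.sum_le_sum step1
  rw [Finset.sum_sub_distrib] at key
  linarith

end GiantKn

namespace GiantKn


/-- **`XZ_T` from a KN-FLOW certificate (PROVED).**  Ladder, `S = insert c T`, `c ∉ T`, points of `S` simultaneously separable with positive
probability; `Δ_B = m_B − m̄_B` the pattern increments (`∅ ≠ B ⊆ T`).  If there is a nonnegative flow `f B' B` along strict inclusions
`B ⊂ B'` with out-flow `Σ_{B⊂B'} f B' B ≤ (Δ_{B'})⁺` and in-flow `Σ_{B'⊃B} f B' B ≥ (Δ_B)⁻` for every block, then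
`μ(o↔T, o light, c heavy) ≤ μ(o↔T, o heavy, c light)`.  (Positive increments may be moved to sub-blocks and negative ones to
super-blocks because `φ_B ≤ φ_{B'}` for `B ⊆ B'`, `phi_mono`; then `xzT_of_certificate`.)  Reach on the top rung of random structured
laws: 87–93 % (prim-lf-7 CANDIDATES batch 8, certificate "F1").
[cite: KozmaNitzan2024, Thm. 2 and Lemmas 1–2; VandenbergHaggstromKahn2005, Thms. 1.3, 1.4, 2.1] -/
theorem xzT_of_knFlow (w : Sym2 (Fin n) → unitInterval) (A S T : Finset (Fin n)) (o c : Fin n) (j : ℕ)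
    (hA : A.card ≤ 2 * j + 1) (hS : S = insert c T) (hc : c ∉ T)
    (hM : 0 < (prodBernoulli w).real {ω : BondConfig (Fin n) | ∀ k ∈ S, ∀ l ∈ S, k ≠ l → ¬ (openGraph ω).Reachable k l})
    (f : Finset (Fin n) → Finset (Fin n) → ℝ) (hf : ∀ B' B, 0 ≤ f B' B)
    (hsup : ∀ B' ∈ T.powerset.filter (fun B => B.Nonempty),
      ∑ B ∈ (T.powerset.filter (fun B => B.Nonempty)).filter (fun B => B ⊂ B'), f B' B ≤
        max ((prodBernoulli w).real {ω : BondConfig (Fin n) | ∀ s ∈ S, (j + 1 ≤ (A.filter fun a => ω ∈ openConn s a).card ↔ s ∈ B')} -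
          (prodBernoulli w).real {ω : BondConfig (Fin n) | ∀ s ∈ S, (j + 1 ≤ (A.filter fun a => ω ∈ openConn s a).card ↔ s ∈ S \ B')}) 0)
    (hdem : ∀ B ∈ T.powerset.filter (fun B => B.Nonempty),
      max (-((prodBernoulli w).real {ω : BondConfig (Fin n) | ∀ s ∈ S, (j + 1 ≤ (A.filter fun a => ω ∈ openConn s a).card ↔ s ∈ B)} -
          (prodBernoulli w).real {ω : BondConfig (Fin n) | ∀ s ∈ S, (j + 1 ≤ (A.filter fun a => ω ∈ openConn s a).card ↔ s ∈ S \ B)})) 0 ≤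
        ∑ B' ∈ (T.powerset.filter (fun B => B.Nonempty)).filter (fun B' => B ⊂ B'), f B' B) :
    (prodBernoulli w).real ((⋃ t ∈ T, (openConn o t : Set (BondConfig (Fin n)))) ∩
        {ω | (A.filter fun a => ω ∈ openConn o a).card ≤ j} ∩ {ω | j + 1 ≤ (A.filter fun a => ω ∈ openConn c a).card}) ≤
      (prodBernoulli w).real ((⋃ t ∈ T, (openConn o t : Set (BondConfig (Fin n)))) ∩
        {ω | j + 1 ≤ (A.filter fun a => ω ∈ openConn o a).card} ∩ {ω | (A.filter fun a => ω ∈ openConn c a).card ≤ j}) := by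
  apply xzT_of_certificate w A S T o c j hA hS hc hM
  set μ := prodBernoulli w with hμ
  have hTS : T ⊆ S := by rw [hS]; exact Finset.subset_insert c T
  set I := T.powerset.filter (fun B => B.Nonempty) with hI
  set m : Finset (Fin n) → ℝ := fun B => μ.real {ω : BondConfig (Fin n) | ∀ s ∈ S, (j + 1 ≤ (A.filter fun a => ω ∈ openConn s a).card ↔ s ∈ B)} with hm
  set mb : Finset (Fin n) → ℝ := fun B => μ.real {ω : BondConfig (Fin n) | ∀ s ∈ S, (j + 1 ≤ (A.filter fun a => ω ∈ openConn s a).card ↔ s ∈ S \ B)} with hmb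
  set d : Finset (Fin n) → ℝ := fun B => μ.real {ω : BondConfig (Fin n) | ∀ s ∈ B, ∀ t ∈ S \ B, ¬ (openGraph ω).Reachable s t} with hd
  set av : Finset (Fin n) → ℝ := fun B => μ.real ({ω : BondConfig (Fin n) | ∀ s ∈ B, ∀ t ∈ S \ B, ¬ (openGraph ω).Reachable s t} ∩
      ⋃ s ∈ B, (openConn s o : Set (BondConfig (Fin n)))) with hav
  set φ : Finset (Fin n) → ℝ := fun B => av B / d B with hφ
  set Δ : Finset (Fin n) → ℝ := fun B => m B - mb B with hΔ
  change 0 ≤ ∑ B ∈ I, φ B * Δ B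
  have hdpos : ∀ B, B ⊆ S → 0 < d B := by
    intro B hBS
    refine lt_of_lt_of_le hM (measureReal_mono ?_ (measure_ne_top _ _))
    intro ω hω s hs t ht
    exact hω s (hBS hs) t (Finset.mem_sdiff.1 ht).1 (fun h => (Finset.mem_sdiff.1 ht).2 (h ▸ hs))
  refine core_flow I φ Δ (· ⊂ ·) f (fun B _ => div_nonneg measureReal_nonneg measureReal_nonneg) ?_ hf ?_ ?_
  · intro B hB B' hB' hBB'
    rw [hI, Finset.mem_filter, Finset.mem_powerset] at hB hB'
    have h := phi_mono w o S B B' hBB'.1 (hB'.1.trans hTS) hM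
    change av B * d B' ≤ d B * av B' at h
    show av B / d B ≤ av B' / d B'
    rw [div_le_div_iff₀ (hdpos B (hB.1.trans hTS)) (hdpos B' (hB'.1.trans hTS))]
    linarith
  · intro B' hB'; exact hsup B' hB'
  · intro B hB; exact hdem B hB

end GiantKn

end Summit.CriticalPhenomena.PercolationContinuityZ3.Theorems

end
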